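import Mathlib
import HarnessLib
import HarnessLib.Audit
import Summits.NavierStokesRegularity.Statement
import Literature.Analysis.FluidPDE.ClassicalSolution
import Literature.Analysis.FluidPDE.LerayHopf
import Literature.Analysis.FluidPDE.VectorCalculus
import Literature.Analysis.FluidPDE.NSWave0
import Summits.NavierStokesRegularity.NavierStokesRegularity.Theorems.TypeICertificateLadderNoBlowupToClay
import HarnessLib.Audit.Status.Attr

/-!
Route: RossbyDichotomy

DORMANT since 2026-09-01T18:02:42Z (reconciler: no traction for 5 d (last activity statement-closed at 2026-08-27T17:27:38Z); parked, not closed — `ledger route dormant route-NavierStokesRegularity-RossbyDichotomy --off` to reactivate) — unstaffed, not closed; items shared with open routes are served there. `ledger route dormant <id> --off` reactivates.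

# Route RossbyDichotomy — NavierStokesRegularity (Clay A), positive side. Card realised:
NavierStokesRegularity/NavierStokesRegularity/self-rotation-coriolis-depletion ("intense cores
Coriolis-stabilise themselves into the 2.5D class"), recorded as an OKUBO–WEISS / LOCAL-ROSSBY
DICHOTOMY AT THE VORTICITY MAXIMUM.

## Objects (inline over existing decls; no new notion needed for the typed items)
ω = curl u (`Literature.Analysis.FluidPDE.curl`). x is a MAX POINT at time t iff ∀ y, ‖ω(t,y)‖ ≤
‖ω(t,x)‖. Local Rossby number Ro(t,x) := ‖S(t,x)‖_op / ‖ω(t,x)‖ = sup_{‖e‖=1} |⟪e, Du(t,x) e⟫| /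
‖ω(t,x)‖ (the quadratic form of Du = fderiv ℝ (u t) x is that of the strain S; ‖Ω‖_op = ½‖ω‖). (t,x)
is ELLIPTIC (rotation-dominated) iff Ro ≤ ½, i.e. ∀ e, ‖e‖ = 1 → |⟪e, Du e⟫| ≤ ½‖ω‖ — the
operator-norm Okubo–Weiss threshold (Weiss1991; in 2-D: closed vs hyperbolic streamlines).
Calibration: the axis of a strained column (Burgers vortex, strain γ, circulation Γ) is elliptic iff
γ ≤ ½ω(0) iff Re_Γ = Γ/ν ≥ 8π ≈ 25; the maximum of a strained vortex LAYER is strictly HYPERBOLIC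
(λ_max(S) = (γ+√(γ²+ω²))/2 > ω/2): tubes ↦ branch 1, sheets ↦ branch 2.

## Thesis X = C1 ∧ C2 ("it suffices to show")
C1 (EllipticMaximaExtend — the card's "local Babin–Mahalov–Nicolaenko" branch): a Leray–Hopf
classical solution from a rapidly decaying datum on ℝ³×[0,T) whose vorticity maxima are all elliptic
for t in some [t₀,T) extends smoothly past T.
C2 (SingularMaximaElliptic — the card's "hand-over" branch): if such a solution admits NO smooth
extension past T, then its vorticity maxima are all elliptic for t in some [t₀,T) (hyperbolic =
strain-dominated maxima do not recur up to a singular time).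
Lean (elaborates, Sketch.lean rc 0; decls EllipticMaximaExtend, SingularMaximaElliptic, Thesis := C1
∧ C2):
 C1: ∀ ν T, 0<ν → 0<T → ∀ u p, IsClassicalNSSolutionOn (Ico 0 T) ν 0 u p → IsLerayHopfOn T ν 0 (u 0)
u → HasRapidSpatialDecay (u 0) → (∃ t₀ ∈ Ico 0 T, ∀ t ∈ Ico t₀ T, ∀ x, (∀ y, ‖curl (u t) y‖ ≤ ‖curl
(u t) x‖) → ∀ e, ‖e‖ = 1 → |⟪e, fderiv ℝ (u t) x e⟫| ≤ (1/2)‖curl (u t) x‖) → HasSmoothExtensionPast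
ν 0 u T
 C2: same frame … → ¬HasSmoothExtensionPast ν 0 u T → ∃ t₀ ∈ Ico 0 T, ∀ t ∈ Ico t₀ T, ∀ x, (max
point) → (elliptic)

## Assembly X → NavierStokesRegularity
C1 → C2 → (NoBlowup → NavierStokesRegularity) → NavierStokesRegularity is PURE LOGIC (proved as
`assembly_holds` in Sketch.lean: a non-extendable solution is eventually elliptic by C2, hence
extendable by C1 — contradiction; so NoBlowup, and the third hypothesis is the shared local-theory
item stmt-NavierStokesRegularity-0055, re-asked here as support NoBlowupToClay).

## Two-layer plan (D-0019)
Layer 1 (cruxes, ranked): C1 (rank 2); C2 (rank 3); KelvinWaveRadiation (rank 4, informal: the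
LINEAR engine of C1 — perturbations of a strained elliptic column radiate/decay at a rate set by the
strain, uniformly in Re_Γ); HandOverTime (rank 5, typed: the card's quantitative hand-over "a
hyperbolic maximum is replaced by elliptic maxima within c/‖ω‖_max" — cheapest falsifier of C2's
engine). Support (rank 9): StretchingAtMaxCriterion (provable now: at a max point D⁺‖ω‖_∞ ≤
α(x*)‖ω‖_∞ because νω·Δω ≤ 0 there, so an integrable majorant of the stretching rate α = ⟪ξ,Sξ⟩ at
the max points bounds sup_t‖ω‖_∞ and BKM closes via beale_kato_majda_holds +
tao2011_hasBoundedSobolevNormsOn_holds), NoBlowupToClay (= stmt-0055).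
Layer 2 (later, glued split of C1 once it has traction): R1 LOCAL-BMN DEPLETION (at an elliptic
maximum the stretching rate is bounded by the EXTERNAL strain σ_ext generated by vorticity outside
the core radius ℓ ≍ (ν/σ)^{1/2} — self-induced stretching of a rotation-dominated core is
dispersively depleted) + R3 NO STRAIN CASCADE (∫₀ᵀ σ_ext dt < ∞ along elliptic maxima of a
finite-energy flow) with glue R1 → R3 → StretchingAtMaxCriterion → C1.

Rationale: WHY THIS LINE. 2.5D (2D-3C) flows are the integrable corner of 3-D NS, and two LARGE-DATA theorems
chart its basin: fast rotation Ω ≥ Ω₀(data) makes 3-D NS global because Poincaré–Coriolis waves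
disperse everything but the resonant 2D-3C interactions (BabinMahalovNicolaenko2001 — where Ω IS the
fluid's own uniformly large vorticity —, MakhalovNikolaenko2003, Chemin–Desjardins–Gallagher–Grenier
2006 zbl:1205.86001), and data slowly varying in one direction are global (CheminGallagherPaicu2011,
named by Tao2016AveragedNS §1.1 p.8 as OUTSIDE the averaged-equation barrier). The card localises
this with an explicit dictionary (Ω ↦ ½|ω(x*)|, Poincaré waves ↦ Kelvin waves of the core,
Taylor–Proudman/resonant set ↦ 2D-3C core dynamics, 'Ω ≥ Ω₀(data)' ↦ 'Ro(x*) ≤ ½'):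
rotation-dominated cores relax toward columnar states whose dominant vorticity is not self-stretched
(HamlingtonSchumacherDahm2008: stretching of intense vorticity is by NONLOCAL strain;
BuariaPumirBodenschatz2020, BuariaLawsonWilczek2024: self-attenuation, twisting vortex lines
regularise; rigorous linear anchors GallayMaekawa2010, Maekawa2011 (stabilisation of the Burgers
vortex in the high-rotation limit), GallaySmets2020, BedrossianGermainHarropgriffiths2023,
MajdaBertozzi2002 §7.4). We record the mechanism as a DICHOTOMY BY THE OKUBO–WEISS TYPE OF THE
VORTICITY MAXIMUM (Weiss1991; threshold Ro = ‖S‖_op/‖ω‖ = ½, no free constant: a strained tube is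
elliptic at its axis iff Re_Γ ≥ 8π, a strained layer is always strictly hyperbolic at its maximum):
C1 = elliptic maxima cannot blow up (dispersive/2.5D branch), C2 = a singular solution cannot keep
producing hyperbolic maxima (Kelvin–Helmholtz hand-over branch, BeronovKida1996); C1 ∧ C2 ⇒ NoBlowup
by pure logic (assembly proved in Sketch.lean). The quantitative pivot is elementary and filed as
provable SUPPORT: at a max point x*, D⁺‖ω‖_∞ ≤ α(x*)‖ω‖_∞ with α = ⟪ξ,Sξ⟫ ≤ Ro(x*)‖ω‖_∞ because
νω·Δω ≤ 0 at a maximum of |ω| (Constantin1994), so blow-up ⇔ the stretching rate AT THE MAXIMUM is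
not time-integrable (StretchingAtMaxCriterion + in-tree beale_kato_majda_holds,
tao2011_hasBoundedSobolevNormsOn_holds). Imported: dispersive PDE / rotating fluids (resonance,
radiation of inertial–Kelvin waves) and hydrodynamic stability (Okubo–Weiss partition, KH roll-up of
strained layers); no probabilistic or spectral reformulation of the ∀-datum problem — the spectral
content sits in the rank-4 linear crux.
RANKED CRUXES. #2 EllipticMaximaExtend (C1, typed) — eventually-elliptic vorticity maxima ⇒
continuation past T (why it might fail: M' ≤ ½M² does not close; with strain imposed from infinity
elliptic cores DO blow up — Burgers-type blow-up under a linear strain γ(t)↑∞,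
MaekawaMiuraPrange2019 — so finite energy must forbid a strain cascade onto the strongest core,
where one-scale-up Biot–Savart bounds lose a logarithm; a DSS blow-up with a tube core of Re_Γ ≥ 8π
refutes it; sources BabinMahalovNicolaenko2001, GallayMaekawa2010, MaekawaMiuraPrange2019,
HamlingtonSchumacherDahm2008). #3 SingularMaximaElliptic (C2, typed) — no extension past T ⇒
eventually all vorticity maxima elliptic (why it might fail: the dangerous numerics are sheet-like
at the maximum for O(1) times — HouLi2006, Hou2022PotentiallySingularNS — and an iterated
sheet→roll-up→sheet cascade, BrennerHormozPumir2016, or any sheet-type singularity gives recurrent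
hyperbolic maxima). #4 KelvinWaveRadiation (informal, added after open; definition request
IsClassicalNSCoriolisSolutionOn filed) — the LOCAL-BMN linear engine: the linearisation of NS at a
strained elliptic column (Burgers vortex, Re_Γ ≥ 8π) damps or radiates axially dependent
(Kelvin-wave) perturbations in a parabolic neighbourhood of the axis at a rate ≳ the strain γ,
uniformly in Re_Γ (why it might fail: on a finite segment Kelvin waves reflect, inviscid columns
have neutral spectrum — GallaySmets2020 — so radiation may degenerate to boundedness; sources
Maekawa2011, GallaySmets2020, BedrossianGermainHarropgriffiths2023, MajdaBertozzi2002 §7.4). #5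
HandOverTime (typed) — ∃ universal c: a hyperbolic maximum at time t is followed within c/‖ω(t)‖_∞
by an instant at which every maximum is elliptic (why it might fail: strained layers persist ≫
1/‖ω‖_∞ when stretching suppresses KH — the Burgers layer is a steady infinite-energy example,
BeronovKida1996; ring collisions keep a hyperbolic sheet maximum for O(1) times numerically).
KILL CRITERIA. C1 refuted (a blow-up with eventually elliptic maxima) or C2 refuted (blow-up with
recurrent hyperbolic maxima) settles ¬Clay(A) and closes every positive route. Route-specific:
KelvinWaveRadiation refuted (no decay beyond neutral Kelvin modes for the strained column, uniformly
in Re_Γ) kills the dispersive engine of C1 ⇒ close `refuted:KelvinWaveRadiation` unless an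
energy-based split of C1 (R3 alone) stands by then; HandOverTime refuted ⇒ C2 loses the card's
engine — restate C2's mechanism (sheet thinning below (ν/γ)^{1/2} ⇒ viscous cancellation) via `route
edit`, or close `exhausted` if #4 is also dead. Okubo–Weiss audit of the
Hou2022PotentiallySingularNS profile: an ELLIPTIC near-singular maximum with Re_Γ → const puts C1 in
direct tension with the best numerics (record as suspect-false evidence on C1).
NOT DECOMPOSED YET. The glued split C1 ⇐ R1 (local-BMN depletion: stretching at an elliptic maximum
≤ C·σ_ext, the strain generated outside the core radius ℓ ≍ (ν/σ)^{1/2}) + R3 (no strain cascade: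
∫₀ᵀ σ_ext dt < ∞ along elliptic maxima of a finite-energy flow) with glue R1 → R3 →
StretchingAtMaxCriterion → C1 — needs a typed exterior-strain functional, filed only once C1 has
traction; the nonlinear hand-over dynamics behind C2 (pressure Hessian at a hyperbolic maximum, Δp =
½|ω|² − |S|² < 0 there; ChaeConstantin2021-type criteria; NeustupaPenel2001 / Miller2019
strain-eigenvalue criteria as tools); CGP anisotropic stability near 2D-3C states (card R4) — enters
only inside a proof of #4/R1; vendoring BMN/CDGG as Literature facts (cite item filed) — hypotheses
for #4 only, never load-bearing for the typed items, whose cone (BKM, Tao2011 persistence) is PROVED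
in tree.
CHEAPEST FALSIFIER. Compute the Okubo–Weiss type Ro(x*) = ‖S‖_op/‖ω‖ at the vorticity maximum of (a)
the Burgers vortex family (done: Ro = 4π/Re_Γ, elliptic iff Re_Γ ≥ 8π), (b) Hou's 2022 interior NS
profile and the Hou–Li anti-parallel data near peak amplification (kit, published fields/fits): if a
near-singular maximum is elliptic with Re_Γ bounded, C1 is suspect; independently, a
certified-numerics run of a head-on vortex-ring collision from Schwartz data exhibiting a hyperbolic
maximum persisting for ≥ 100/‖ω‖_∞ kills HandOverTime (rank 5) in an afternoon.
TWO-LAYER PLAN. Layer 1 = the four cruxes above + support StretchingAtMaxCriterion (provable now)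
and NoBlowupToClay (= stmt-NavierStokesRegularity-0055, shared). Layer 2 = the glued split of C1
into R1/R3 (k = 2) and, if HandOverTime dies, a resplit of C2's engine; never a third layer.
NUMBERS. Threshold Ro = ½ (operator norm) ⇔ |λ_max(S)| ≤ ‖Ω‖_op = ½‖ω‖; Burgers axis: Ro = γ/ω(0) =
4πν/Γ, elliptic iff Re_Γ ≥ 8π ≈ 25.1; Gaussian column: self-induced strain inside the factor-2
vorticity window ≤ 0.11 ω_max, zero on the axis; strained layer: λ_max(S) = (γ+√(γ²+ω²))/2 > ω/2
strictly. Items at open: 7 typed (target, assembly, 3 cruxes, 2 support) + 1 informal crux after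
open = 8 ≤ 15.
DEFINITION REQUESTS. IsClassicalNSCoriolisSolutionOn (NS with Coriolis force Ωe₃×u, the BMN/CDGG
setting; Literature/Analysis/FluidPDE) — to type #4 and to vendor BMN2001 as a named fact; nothing
else (max points, ellipticity, stretching form are inline over curl/fderiv).

Novelty: NOVELTY (planner pass 2026-08-15; search-before-claim log below; the card's own audit by
refuter-novelty-audit-10 graded it new-combination on the same prior art).
Nearest prior art. (1) The HEADLINE move in GLOBAL form is known: BabinMahalovNicolaenko2001 (IUMJ
50: data = arbitrary field + (Ω/2)e₃×y, regular for Ω ≥ Ω₀(data) — the Coriolis parameter IS the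
fluid's own uniformly large vorticity), MakhalovNikolaenko2003 (RMS 58), BMN 1999 (IUMJ 48,
zbl:0932.35160), Chemin–Desjardins–Gallagher–Grenier 2006 (OUP, zbl:1205.86001);
CheminGallagherPaicu2011 for the 2.5D/anisotropic basin. (2) Conditional regularity through the
STRAIN rather than the vorticity: NeustupaPenel2001 (one eigenvalue of S), Miller2019 (= Miller ARMA
235 (2020), arXiv:1710.05569: λ₂⁺ ∈ L^p_tL^q_x, 2/p+3/q = 2), ChaeConstantin2021 (IMRN;
arXiv:2012.11948 pp.1-2 read: ‖D²p‖_∞-criteria, Euler), Constantin1994 (SIAM Rev. 36: stretching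
rate α = ⟪ξ,Sξ⟫ and its nonlocal representation), DengHouYu2006 / HouLi2006 (local geometric
non-blow-up conditions on vortex-line segments through the maximum, dynamic depletion numerics),
Grujić arXiv:2607.08866 (pp.1-2 read: log-bmo direction field ⇒ logarithmic depletion; a
direction-coherence mechanism, not a strain-type one). (3) Linear/nonlinear stability of the local
models: GallayMaekawa2010 (3-D stability of Burgers vortices, all Re), Maekawa2011 (JMFM 13:
stabilisation of the Burgers vortex in the HIGH-ROTATION limit — the local 'self-rotation' effect
for 2-D perturba  [refs: 1710.05569, 2012.11948, 2607.08866, 1811.07584, math/0703405, BabinMahalovNicolaenko2001, MakhalovNikolaenko2003, CheminGallagherPaicu2011, NeustupaPenel2001, Miller2019, ChaeConstantin2021, Constantin1994, DengHouYu2006, HouLi2006, GallayMaekawa2010, Maekawa2011, GallaySmets2020, BedrossianGermainHarropgriffiths2023, MaekawaMiuraPrange2019, BeronovKida1996, MajdaBertozzi2002, HamlingtonSchumacher]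

Barriers (technique_class: okubo-weiss-max-dichotomy self-rotation-dispersion): - technique_class: okubo-weiss-max-dichotomy self-rotation-dispersion hand-over
- Literature.Barriers.NavierStokesRegularity.TaoAveragedBlowup: EVADED IN KIND — every typed item is
a statement about the pointwise geometry of Du at the vorticity MAXIMUM (Okubo–Weiss type, sign of
νω·Δω at a maximum of |ω|, stretching form ⟪ω,Du ω⟫): fine real structure of the true nonlinearity
(vorticity transport + Biot–Savart) that an averaged operator B̃ does not carry (no vorticity
maximum principle, no inertial/Kelvin-wave dispersion relation ±Ω k_z/|k| — averaging over
multipliers and rotations destroys both). The foreseen engines are the catalogue's own recorded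
evasions: resonance/dispersion of the Coriolis operator (BabinMahalovNicolaenko2001) and CGP
anisotropy (evasions_known: CheminGallagherPaicu2011; Tao2016AveragedNS §1.1 p.8), plus KH
instability of strained layers for C2. Residual exposure: an attack on C1 by energy-class multiscale
bounds alone (card R3 without R1) re-enters the class and meets the logarithmic loss.
- Literature.Barriers.NavierStokesRegularity.TruncatedDyadicBlowup: same as above (sub-class of
Tao's); additionally the line USES autonomy/fine structure (maximum-point calculus of the true
vorticity equation), which the exogenous time-dependent model lacks.
- Literature.Barriers.NavierStokesRegularity.EnergySupercriticality: APPLIES, NOT evaded by a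
coercive quantity. Ro(x*) is dimensionless (critical) and C1/C2 are a-priori statements about it won
from supercrit

History (route lifecycle, newest last):
- 2026-08-22T17:48:18Z · DORMANT — reconciler: no traction for 5.5 d (last activity item-evidence-added at 2026-08-17T04:21:05Z); parked, not closed — `ledger route dormant route-NavierStokesRegu (operator:999:2349258)
- 2026-08-26T16:59:38Z · REACTIVATED — reconciler: reactivated — activity statement-closed at 2026-08-26T16:08:58Z after parking at 2026-08-22T17:48:18Z (operator:999:3417525)
- 2026-09-01T18:02:42Z · DORMANT — reconciler: no traction for 5 d (last activity statement-closed at 2026-08-27T17:27:38Z); parked, not closed — `ledger route dormant route-NavierStokesRegularit (operator:999:3016412)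

sub-problem: NavierStokesRegularity · status: dormant · opened planner-plancard-NavierStokesRegularity-Navie-02140b65-0 2026-08-15T11:09:27Z · rev 2 · ledger route-NavierStokesRegularity-RossbyDichotomy
GENERATED by the gate from the ledger (D-0016/17). Provers cite these decls: `theorem foo : Summit.NavierStokesRegularity.NavierStokesRegularity.Theses.RossbyDichotomy.<Decl> := …` in Summits/NavierStokesRegularity/NavierStokesRegularity/Theorems/<Name>.lean.
-/

namespace Summit.NavierStokesRegularity.NavierStokesRegularity.Theses.RossbyDichotomy

open scoped BigOperators Topology Manifold Classical MeasureTheory ProbabilityTheory Matrix InnerProductSpace ComplexConjugate ContinuousMap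
open Filter Set Function TopologicalSpace MeasureTheory

attribute [summit_statement] _root_.NavierStokesRegularity

open Literature.NS

/-- item stmt-NavierStokesRegularity-2918 · target · rank 0 · open · by planner
why it might fail: X ⇔ NoBlowup overall (by design); fails iff a Schwartz datum blows up — then exactly one of C1/C2 is false (elliptic-core DSS kills C1, recurrent sheets kill C2).
sources: BabinMahalovNicolaenko2001, Weiss1991, Hou2022PotentiallySingularNS, Tao2016AveragedNS
[target] X = EllipticMaximaExtend ∧ SingularMaximaElliptic (Okubo–Weiss dichotomy at the vorticity
maximum, threshold Ro = ‖S‖_op/‖ω‖ ≤ ½): (C1) a Leray–Hopf classical solution from a rapidly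
decaying datum whose vorticity maxima are eventually all elliptic extends past T; (C2) a solution
with no smooth extension past T has eventually elliptic vorticity maxima. Card:
self-rotation-coriolis-depletion. -/
@[route_item "route-NavierStokesRegularity-RossbyDichotomy"]
def Thesis : Prop :=
  (∀ (ν T : ℝ), 0 < ν → 0 < T → ∀ (u : ℝ → EuclideanSpace ℝ (Fin 3) → EuclideanSpace ℝ (Fin 3)) (p : ℝ → EuclideanSpace ℝ (Fin 3) → ℝ), Literature.Analysis.FluidPDE.IsClassicalNSSolutionOn (Set.Ico 0 T) ν 0 u p → Literature.Analysis.FluidPDE.IsLerayHopfOn T ν 0 (u 0) u → Literature.Analysis.FluidPDE.HasRapidSpatialDecay (u 0) → (∃ t₀ ∈ Set.Ico 0 T, ∀ t ∈ Set.Ico t₀ T, ∀ x : EuclideanSpace ℝ (Fin 3), (∀ y, ‖Literature.Analysis.FluidPDE.curl (u t) y‖ ≤ ‖Literature.Analysis.FluidPDE.curl (u t) x‖) → ∀ e : EuclideanSpace ℝ (Fin 3), ‖e‖ = 1 → |inner ℝ e (fderiv ℝ (u t) x e)| ≤ (1 / 2 : ℝ) * ‖Literature.Analysis.FluidPDE.curl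 (u t) x‖) → Literature.Analysis.FluidPDE.HasSmoothExtensionPast ν 0 u T) ∧ (∀ (ν T : ℝ), 0 < ν → 0 < T → ∀ (u : ℝ → EuclideanSpace ℝ (Fin 3) → EuclideanSpace ℝ (Fin 3)) (p : ℝ → EuclideanSpace ℝ (Fin 3) → ℝ), Literature.Analysis.FluidPDE.IsClassicalNSSolutionOn (Set.Ico 0 T) ν 0 u p → Literature.Analysis.FluidPDE.IsLerayHopfOn T ν 0 (u 0) u → Literature.Analysis.FluidPDE.HasRapidSpatialDecay (u 0) → ¬ Literature.Analysis.FluidPDE.HasSmoothExtensionPast ν 0 u T → ∃ t₀ ∈ Set.Ico 0 T, ∀ t ∈ Set.Ico t₀ T, ∀ x : EuclideanSpace ℝ (Fin 3), (∀ y, ‖Literature.Analysis.FluidPDE.curl (u t) y‖ ≤ ‖Literature.Analysis.FluidPDE.curl (u t) x‖) → ∀ e : EuclideanSpace ℝ (Fin 3), ‖e‖ = 1 → |inner ℝ e (fderiv ℝ (u t) x e)| ≤ (1 / 2 : ℝ) * ‖Literature.Analysis.FluidPDE.curl (u t) x‖)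

/-- item stmt-NavierStokesRegularity-2920 · crux · rank 2 · open · by planner
why it might fail: M' ≤ ½M² does not close; elliptic cores DO blow up under strain imposed from infinity (MaekawaMiuraPrange2019), so finite energy must forbid a strain cascade (log loss one scale up); an elliptic-core DSS blow-up (Re_Γ ≥ 8π, Ro = O(1) profile constant) refutes it.
sources: BabinMahalovNicolaenko2001, MakhalovNikolaenko2003, CheminGallagherPaicu2011, GallayMaekawa2010, Maekawa2011, MaekawaMiuraPrange2019
[crux] C1, the card's LOCAL-BMN branch: for ν>0 and a classical NS solution on ℝ³×[0,T), Leray–Hopf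
from a rapidly decaying datum, if there is t₀<T such that for every t ∈ [t₀,T) every spatial maximum
point x of |curl u(t,·)| is ELLIPTIC — ∀ unit e, |⟪e, Du(t,x)e⟫| ≤ ½‖curl u(t,x)‖, i.e. local Rossby
number ‖S‖_op/‖ω‖ ≤ ½ (operator-norm Okubo–Weiss; a strained tube qualifies iff Re_Γ ≥ 8π) — then
the solution extends smoothly past T. Expected proof shape: StretchingAtMaxCriterion reduces it to
time-integrability of the stretching rate α(x*) at elliptic maxima; α(x*) is the EXTERNAL strain
felt by a rotation-dominated core (self-induced stretching depleted: 2D-3C relaxation / Kelvin-wave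
radiation in the frame co-rotating at ½|ω(x*)| — BMN dispersion localised, KelvinWaveRadiation) and
a finite-energy flow cannot cascade strain onto its strongest core (card R3). [deps:
StretchingAtMaxCriterion, KelvinWaveRadiation] [difficulty: open-problem] -/
@[route_item "route-NavierStokesRegularity-RossbyDichotomy", crux]
def EllipticMaximaExtend : Prop :=
  ∀ (ν T : ℝ), 0 < ν → 0 < T → ∀ (u : ℝ → EuclideanSpace ℝ (Fin 3) → EuclideanSpace ℝ (Fin 3)) (p : ℝ → EuclideanSpace ℝ (Fin 3) → ℝ), Literature.Analysis.FluidPDE.IsClassicalNSSolutionOn (Set.Ico 0 T) ν 0 u p → Literature.Analysis.FluidPDE.IsLerayHopfOn T ν 0 (u 0) u → Literature.Analysis.FluidPDE.HasRapidSpatialDecay (u 0) → (∃ t₀ ∈ Set.Ico 0 T, ∀ t ∈ Set.Ico t₀ T, ∀ x : EuclideanSpace ℝ (Fin 3), (∀ y, ‖Literature.Analysis.FluidPDE.curl (u t) y‖ ≤ ‖Literature.Analysis.FluidPDE.curl (u t) x‖) → ∀ e : EuclideanSpace ℝ (Fin 3), ‖e‖ = 1 → |inner ℝ e (fderiv ℝ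 (u t) x e)| ≤ (1 / 2 : ℝ) * ‖Literature.Analysis.FluidPDE.curl (u t) x‖) → Literature.Analysis.FluidPDE.HasSmoothExtensionPast ν 0 u T

/-- item stmt-NavierStokesRegularity-2921 · crux · rank 3 · open · by planner
why it might fail: Dangerous numerics are sheet-like at the maximum for O(1) times (HouLi2006, Hou2022); an iterated sheet→roll-up→sheet cascade (BrennerHormozPumir2016) or a sheet-type singularity yields hyperbolic maxima recurring up to T.
sources: Weiss1991, BeronovKida1996, BrennerHormozPumir2016, HouLi2006, Hou2022PotentiallySingularNS, ChaeConstantin2021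
[crux] C2, the card's HAND-OVER branch as an a-priori statement: for ν>0 and a classical NS solution
on ℝ³×[0,T), Leray–Hopf from a rapidly decaying datum, with NO smooth extension past T, there is
t₀<T such that for all t ∈ [t₀,T) every maximum point of |curl u(t,·)| is elliptic (∀ unit e, |⟪e,Du
e⟫| ≤ ½‖ω‖). Contrapositive: hyperbolic (strain-dominated, sheet-like: a strained layer has λ_max(S)
= (γ+√(γ²+ω²))/2 > ω/2) vorticity maxima cannot recur up to a singular time — a maximum under
dominant strain is sheared apart / rolls up (Kelvin–Helmholtz) and hands over to tube-like elliptic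
maxima. Mechanism candidates: maximum-point analysis with the pressure Hessian (Δp = ½|ω|² − |S|² <
0 at a hyperbolic maximum), KH instability of strained layers (BeronovKida1996), viscous
cancellation of layers thinner than (ν/γ)^{1/2}. [deps: HandOverTime] [difficulty: open-problem] -/
@[route_item "route-NavierStokesRegularity-RossbyDichotomy", crux]
def SingularMaximaElliptic : Prop :=
  ∀ (ν T : ℝ), 0 < ν → 0 < T → ∀ (u : ℝ → EuclideanSpace ℝ (Fin 3) → EuclideanSpace ℝ (Fin 3)) (p : ℝ → EuclideanSpace ℝ (Fin 3) → ℝ), Literature.Analysis.FluidPDE.IsClassicalNSSolutionOn (Set.Ico 0 T) ν 0 u p → Literature.Analysis.FluidPDE.IsLerayHopfOn T ν 0 (u 0) u → Literature.Analysis.FluidPDE.HasRapidSpatialDecay (u 0) → ¬ Literature.Analysis.FluidPDE.HasSmoothExtensionPast ν 0 u T → ∃ t₀ ∈ Set.Ico 0 T, ∀ t ∈ Set.Ico t₀ T, ∀ x : EuclideanSpace ℝ (Fin 3), (∀ y, ‖Literature.Analysis.FluidPDE.curl (u t) y‖ ≤ ‖Literature.Analysis.FluidPDE.curl (u t) x‖)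 → ∀ e : EuclideanSpace ℝ (Fin 3), ‖e‖ = 1 → |inner ℝ e (fderiv ℝ (u t) x e)| ≤ (1 / 2 : ℝ) * ‖Literature.Analysis.FluidPDE.curl (u t) x‖

-- item stmt-NavierStokesRegularity-3054 · crux · rank 4 · open · by planner — informal only, no Lean statement yet:
--   [crux] (rank 4; informal until the notions `IsClassicalNSCoriolisSolutionOn` / a strained-column
--   linearisation exist — definition request filed) KELVIN-WAVE RADIATION = the LINEAR ENGINE of C1, the
--   card's "local Babin–Mahalov–Nicolaenko" estimate (R1) in its cheapest decisive form. Setting: the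
--   Burgers vortex U_B (circulation Γ, axial strain u_s = γ(−x/2, −y/2, z), core radius (ν/γ)^{1/2};
--   circulation Reynolds number Re_Γ = Γ/ν ≥ 8π so that its axis is an ELLIPTIC vorticity maximum, Ro =
--   4π/Re_Γ ≤ ½). CLAIM: the linearisation of 3-D Navier–Stokes at U_B, acting on finite-energy
--   perturbations t

/-- item stmt-NavierStokesRegularity-2922 · crux · rank 5 · open · by planner
why it might fail: Strained layers persist ≫ 1/‖ω‖_∞ when stretching suppresses KH: the Burgers vortex layer is a steady (infinite-energy) hyperbolic maximum (BeronovKida1996); ring collisions keep a hyperbolic sheet maximum for O(1) times numerically.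
sources: BeronovKida1996, HouLi2006, BrennerHormozPumir2016, MajdaBertozzi2002
[crux] The card's QUANTITATIVE hand-over lemma (R2), cheapest falsifier of C2's engine: there is a
universal c>0 such that for every ν>0 and every classical NS solution on ℝ³×[0,T), Leray–Hopf from a
rapidly decaying datum, every t ∈ [0,T) and every maximum point x of |curl u(t,·)| that is
HYPERBOLIC (some unit e has |⟪e,Du(t,x)e⟫| > ½‖curl u(t,x)‖), if t + c/‖curl u(t,x)‖ < T then at
some s ∈ [t, t + c/‖curl u(t,x)‖] EVERY maximum point of |curl u(s,·)| is elliptic. Scale-invariant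
(c/‖ω‖_max is a time). Refutable WITHOUT a blow-up: a family of smooth finite-energy flows whose
hyperbolic maximum persists for ≫ 1/‖ω‖_∞ (certified numerics on explicit Schwartz data, e.g.
head-on vortex-ring collision, or a perturbative construction around a truncated Burgers layer).
Refutation demotes the card's R2 engine but leaves C2's truth open. [difficulty: L] -/
@[route_item "route-NavierStokesRegularity-RossbyDichotomy"]
def HandOverTime : Prop :=
  ∃ c : ℝ, 0 < c ∧ ∀ (ν T : ℝ), 0 < ν → 0 < T → ∀ (u : ℝ → EuclideanSpace ℝ (Fin 3) → EuclideanSpace ℝ (Fin 3)) (p : ℝ → EuclideanSpace ℝ (Fin 3) → ℝ), Literature.Analysis.FluidPDE.IsClassicalNSSolutionOn (Set.Ico 0 T) ν 0 u p → Literature.Analysis.FluidPDE.IsLerayHopfOn T ν 0 (u 0) u → Literature.Analysis.FluidPDE.HasRapidSpatialDecay (u 0) → ∀ t ∈ Set.Ico 0 T, ∀ x : EuclideanSpace ℝ (Fin 3), (∀ y, ‖Literature.Analysis.FluidPDE.curl (u t) y‖ ≤ ‖Literature.Analysis.FluidPDE.curl (u t) x‖) → (∃ e : EuclideanSpace ℝ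 (Fin 3), ‖e‖ = 1 ∧ (1 / 2 : ℝ) * ‖Literature.Analysis.FluidPDE.curl (u t) x‖ < |inner ℝ e (fderiv ℝ (u t) x e)|) → t + c / ‖Literature.Analysis.FluidPDE.curl (u t) x‖ < T → ∃ s ∈ Set.Icc t (t + c / ‖Literature.Analysis.FluidPDE.curl (u t) x‖), ∀ x' : EuclideanSpace ℝ (Fin 3), (∀ y, ‖Literature.Analysis.FluidPDE.curl (u s) y‖ ≤ ‖Literature.Analysis.FluidPDE.curl (u s) x'‖) → ∀ e : EuclideanSpace ℝ (Fin 3), ‖e‖ = 1 → |inner ℝ e (fderiv ℝ (u s) x' e)| ≤ (1 / 2 : ℝ) * ‖Literature.Analysis.FluidPDE.curl (u s) x'‖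

/-- item stmt-NavierStokesRegularity-0055 · support · rank 9 · closed · proved by Summit.NavierStokesRegularity.NavierStokesRegularity.Theorems.typeICertificateLadder_noBlowupToClay_proof @ 8d57e70af7e2 (prover) · by planner
sources: Fefferman2000, Leray1934, FujitaKato1964, Tao2011
Given NoBlowup, build the Clay (A) solution: local finite-energy classical solution for smooth
divergence-free rapidly decaying data (Leray 1934 §III / Fujita–Kato 1964 + LPS smoothing), continue
past every T using NoBlowup, glue by weak–strong uniqueness (Prodi–Serrin), bounded energy from the
energy inequality, and convert with
Literature.Analysis.FluidPDE.isNavierStokesSolution_and_smooth_iff. Blow-up at spatial infinity is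
excluded by CKN ε-regularity applied far out. May take named Literature facts (leray_existence_R3,
ladyzhenskaya_prodi_serrin, weak_strong_uniqueness, fujita_kato_local) as hypotheses if the grounder
so rules. -/
@[route_item "route-NavierStokesRegularity-RossbyDichotomy", crux]
def NoBlowupToClay : Prop :=
  (∀ (ν T : ℝ), 0 < ν → 0 < T → ∀ (u : ℝ → EuclideanSpace ℝ (Fin 3) → EuclideanSpace ℝ (Fin 3)) (p : ℝ → EuclideanSpace ℝ (Fin 3) → ℝ), Literature.Analysis.FluidPDE.IsClassicalNSSolutionOn (Set.Ico 0 T) ν 0 u p → Literature.Analysis.FluidPDE.IsLerayHopfOn T ν 0 (u 0) u → Literature.Analysis.FluidPDE.HasRapidSpatialDecay (u 0) → Literature.Analysis.FluidPDE.HasSmoothExtensionPast ν 0 u T) → NavierStokesRegularity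

/-- `NoBlowupToClay` holds: proved by `Summit.NavierStokesRegularity.NavierStokesRegularity.Theorems.typeICertificateLadder_noBlowupToClay_proof` @ 8d57e70af7e2. -/
theorem NoBlowupToClay_holds : NoBlowupToClay := _root_.Summit.NavierStokesRegularity.NavierStokesRegularity.Theorems.typeICertificateLadder_noBlowupToClay_proof

/-- item stmt-NavierStokesRegularity-2923 · support · rank 9 · closed · proved by Summit.NavierStokesRegularity.NavierStokesRegularity.Theorems.rossbyDichotomy_stretchingAtMaxCriterion_proof (prover) · by planner
sources: Constantin1994, BealeKatoMajda1984, MajdaBertozzi2002, Tao2011, arXiv:math/0703405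
[support] Stretching-at-the-maximum continuation criterion (provable now; folklore: Constantin1994,
Chae Handbook 2008 arXiv:math/0703405 for Euler; the viscous term has the good sign at a maximum):
for ν>0 and a classical NS solution on ℝ³×[0,T), Leray–Hopf from a rapidly decaying datum, if there
is g integrable on (0,T) with ⟪ω, Du ω⟫(t,x) ≤ g(t)‖ω(t,x)‖² at every maximum point x of |ω(t,·)|, t
∈ [0,T), then the solution extends past T. Proof plan (~150 lines): M(t) = max|ω(t,·)| is attained
(ω(t) ∈ H^k ∀k by tao2011_hasBoundedSobolevNormsOn_holds + Sobolev); at a max point ∂_t(|ω|²/2) =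
⟪ω,Du ω⟫ + ν⟪ω,Δω⟫ − u·∇(|ω|²/2) with the last term 0 and ν⟪ω,Δω⟫ = ν(Δ|ω|²/2 − |∇ω|²) ≤ 0;
Danskin/upper-Dini argument gives D⁺M ≤ g M, Grönwall bounds sup_{t<T} M(t), hence ∫₀ᵀ sup|curl u| <
∞ and beale_kato_majda_holds (+ BKM-class persistence as in
Literature.NS.vorticityGeometry_persistence_of_tao_sobolev_bounds) yields HasSobolevExtensionPast ⇒
HasSmoothExtensionPast. Degenerate case ω(t₁) ≡ 0: finite-energy curl-free div-free ⇒ u(t₁) = 0 ⇒ u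
≡ 0 after t₁ by IsClassicalNSSolutionOn.eq_of_memSobolevX. [difficulty: M] [provable-now] -/
@[route_item "route-NavierStokesRegularity-RossbyDichotomy"]
def StretchingAtMaxCriterion : Prop :=
  ∀ (ν T : ℝ), 0 < ν → 0 < T → ∀ (u : ℝ → EuclideanSpace ℝ (Fin 3) → EuclideanSpace ℝ (Fin 3)) (p : ℝ → EuclideanSpace ℝ (Fin 3) → ℝ), Literature.Analysis.FluidPDE.IsClassicalNSSolutionOn (Set.Ico 0 T) ν 0 u p → Literature.Analysis.FluidPDE.IsLerayHopfOn T ν 0 (u 0) u → Literature.Analysis.FluidPDE.HasRapidSpatialDecay (u 0) → (∃ g : ℝ → ℝ, MeasureTheory.IntegrableOn g (Set.Ioo 0 T) ∧ ∀ t ∈ Set.Ico 0 T, ∀ x : EuclideanSpace ℝ (Fin 3), (∀ y, ‖Literature.Analysis.FluidPDE.curl (u t) y‖ ≤ ‖Literature.Analysis.FluidPDE.curl (u t) x‖) → inner ℝ (Literature.Analysis.FluidPDE.curl (u t) x) (fderiv ℝ (u t) x (Literature.Analysis.FluidPDE.curl (u t) x)) ≤ g t * ‖Literature.Analysis.FluidPDE.curl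 (u t) x‖ ^ 2) → Literature.Analysis.FluidPDE.HasSmoothExtensionPast ν 0 u T

-- `StretchingAtMaxCriterion` holds: proved by `Summit.NavierStokesRegularity.NavierStokesRegularity.Theorems.rossbyDichotomy_stretchingAtMaxCriterion_proof` (its module imports this route file, so no `_holds` link can be stated here).

/-- item stmt-NavierStokesRegularity-3579 · support · rank 9 · closed · proved by Summit.NavierStokesRegularity.NavierStokesRegularity.Theorems.rossbyDichotomy_vorticityEquation_proof (prover) · by planner
[support] VORTICITY TRANSPORT EQUATION for classical NS solutions — the tier-0 debt of this line,
restated INSIDE the route's minimal import cone (ClassicalSolution + VectorCalculus only): for ν>0,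
T>0 and a classical unforced NS solution (u,p) on ℝ³×[0,T) (IsClassicalNSSolutionOn (Ico 0 T) ν 0 u
p), ω = curl u satisfies ∂ₜω + (u·∇)ω = (ω·∇)u + νΔω pointwise on [0,T)×ℝ³, with ∂ₜ =
timeDerivWithin (Ico 0 T) exactly as in IsClassicalNSSolutionOn.momentum, (a·∇)b = convect a b, Δ =
Laplacian.laplacian. This is DEFINITIONALLY the `vorticity_eq` field of IsVorticitySolutionOn (Ico 0
T) ν u (vorticity u = fun t => curl (u t), rfl), i.e. the f = 0, S = Ico 0 T case of the NAMED FACT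
Literature.Analysis.FluidPDE.IsClassicalNSSolutionOn.isVorticitySolutionOn
(Literature/Analysis/FluidPDE/Vorticity.lean; MajdaBertozzi2002 Prop. 2.21 forward direction, eqs.
(2.109)–(2.110)), which is UNPROVED in tree (no `_holds`): needs-fact:
Literature.Analysis.FluidPDE.IsClassicalNSSolutionOn.isVorticitySolutionOn. Preferred proof:
discharge that fact as `IsClassicalNSSolutionOn.isVorticitySolutionOn_holds` in Literature (take the
curl of `momentum`: ∂ₜ within Ico 0 T commutes with the spatial curl under j -/
@[route_item "route-NavierStokesRegularity-RossbyDichotomy"]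
def VorticityEquation : Prop :=
  ∀ (ν T : ℝ), 0 < ν → 0 < T → ∀ (u : ℝ → EuclideanSpace ℝ (Fin 3) → EuclideanSpace ℝ (Fin 3)) (p : ℝ → EuclideanSpace ℝ (Fin 3) → ℝ), Literature.Analysis.FluidPDE.IsClassicalNSSolutionOn (Set.Ico 0 T) ν 0 u p → ∀ t ∈ Set.Ico 0 T, ∀ x : EuclideanSpace ℝ (Fin 3), Literature.Analysis.FluidPDE.timeDerivWithin (Set.Ico 0 T) (fun s => Literature.Analysis.FluidPDE.curl (u s)) t x + Literature.Analysis.FluidPDE.convect (u t) (Literature.Analysis.FluidPDE.curl (u t)) x = Literature.Analysis.FluidPDE.convect (Literature.Analysis.FluidPDE.curl (u t)) (u t) x + ν • Laplacian.laplacian (Literature.Analysis.FluidPDE.curl (u t)) x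

-- `VorticityEquation` holds: proved by `Summit.NavierStokesRegularity.NavierStokesRegularity.Theorems.rossbyDichotomy_vorticityEquation_proof` (its module imports this route file, so no `_holds` link can be stated here).

/-- item stmt-NavierStokesRegularity-2919 · assembly · rank 1 · closed · proved by Summit.NavierStokesRegularity.NavierStokesRegularity.Theorems.rossbyDichotomy_assembly_proof (prover) · by planner
sources: Fefferman2000, BealeKatoMajda1984
[assembly] EllipticMaximaExtend → SingularMaximaElliptic → NoBlowupToClay (=
stmt-NavierStokesRegularity-0055: NoBlowup → A) → NavierStokesRegularity. PURE LOGIC, proved as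
`assembly_holds` in the planner's Sketch.lean (5 lines): given a Leray–Hopf classical solution from
a rapidly decaying datum on [0,T), if it had no extension then C2 makes its maxima eventually
elliptic and C1 extends it — contradiction; feed NoBlowup to the third hypothesis. -/
@[route_item "route-NavierStokesRegularity-RossbyDichotomy"]
def Assembly : Prop :=
  (∀ (ν T : ℝ), 0 < ν → 0 < T → ∀ (u : ℝ → EuclideanSpace ℝ (Fin 3) → EuclideanSpace ℝ (Fin 3)) (p : ℝ → EuclideanSpace ℝ (Fin 3) → ℝ), Literature.Analysis.FluidPDE.IsClassicalNSSolutionOn (Set.Ico 0 T) ν 0 u p → Literature.Analysis.FluidPDE.IsLerayHopfOn T ν 0 (u 0) u → Literature.Analysis.FluidPDE.HasRapidSpatialDecay (u 0) → (∃ t₀ ∈ Set.Ico 0 T, ∀ t ∈ Set.Ico t₀ T, ∀ x : EuclideanSpace ℝ (Fin 3), (∀ y, ‖Literature.Analysis.FluidPDE.curl (u t) y‖ ≤ ‖Literature.Analysis.FluidPDE.curl (u t) x‖) → ∀ e : EuclideanSpace ℝ (Fin 3), ‖e‖ = 1 → |inner ℝ e (fderiv ℝ (u t) x e)| ≤ (1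 / 2 : ℝ) * ‖Literature.Analysis.FluidPDE.curl (u t) x‖) → Literature.Analysis.FluidPDE.HasSmoothExtensionPast ν 0 u T) → (∀ (ν T : ℝ), 0 < ν → 0 < T → ∀ (u : ℝ → EuclideanSpace ℝ (Fin 3) → EuclideanSpace ℝ (Fin 3)) (p : ℝ → EuclideanSpace ℝ (Fin 3) → ℝ), Literature.Analysis.FluidPDE.IsClassicalNSSolutionOn (Set.Ico 0 T) ν 0 u p → Literature.Analysis.FluidPDE.IsLerayHopfOn T ν 0 (u 0) u → Literature.Analysis.FluidPDE.HasRapidSpatialDecay (u 0) → ¬ Literature.Analysis.FluidPDE.HasSmoothExtensionPast ν 0 u T → ∃ t₀ ∈ Set.Ico 0 T, ∀ t ∈ Set.Ico t₀ T, ∀ x : EuclideanSpace ℝ (Fin 3), (∀ y, ‖Literature.Analysis.FluidPDE.curl (u t) y‖ ≤ ‖Literature.Analysis.FluidPDE.curl (u t) x‖) → ∀ e : EuclideanSpace ℝ (Fin 3), ‖e‖ = 1 → |inner ℝ e (fderiv ℝ (u t) x e)| ≤ (1 / 2 : ℝ) * ‖Literature.Analysis.FluidPDE.curl (u t) x‖)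 → ((∀ (ν T : ℝ), 0 < ν → 0 < T → ∀ (u : ℝ → EuclideanSpace ℝ (Fin 3) → EuclideanSpace ℝ (Fin 3)) (p : ℝ → EuclideanSpace ℝ (Fin 3) → ℝ), Literature.Analysis.FluidPDE.IsClassicalNSSolutionOn (Set.Ico 0 T) ν 0 u p → Literature.Analysis.FluidPDE.IsLerayHopfOn T ν 0 (u 0) u → Literature.Analysis.FluidPDE.HasRapidSpatialDecay (u 0) → Literature.Analysis.FluidPDE.HasSmoothExtensionPast ν 0 u T) → NavierStokesRegularity) → NavierStokesRegularity

-- `Assembly` holds: proved by `Summit.NavierStokesRegularity.NavierStokesRegularity.Theorems.rossbyDichotomy_assembly_proof` (its module imports this route file, so no `_holds` link can be stated here).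

/-! D-0027 §2.1 — DECIDING THEOREM (planner-authored via `route open/edit --closes-file`; by planner-rbadge-NavierStokesRegularity-RossbyDi-02e9208c-g2-0 2026-08-15T16:13:28Z):
its hypotheses are this route's items and its conclusion the sub-problem Statement (glue_lint), and it elaborates with this file. -/

/-- DECIDING THEOREM (D-0027 §2.1): the Okubo–Weiss dichotomy closes by pure logic. Fix a
Leray–Hopf classical solution from a rapidly decaying datum on `[0,T)`; if it had no smooth
extension past `T`, `SingularMaximaElliptic` (C2) makes its vorticity maxima eventually all
elliptic and `EllipticMaximaExtend` (C1) then extends it — contradiction; so NoBlowup holds, and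
`NoBlowupToClay` (= stmt-NavierStokesRegularity-0055, the shared local-theory item) returns the
Clay (A) solution. Proved sorry-free by the planner. -/
@[closes "route-NavierStokesRegularity-RossbyDichotomy"] theorem closes (hC1 : EllipticMaximaExtend) (hC2 : SingularMaximaElliptic)
    (hClay : NoBlowupToClay) : NavierStokesRegularity := by
  apply hClay
  intro ν T hν hT u p hcl hLH hdec
  by_contra hext
  exact hext (hC1 ν T hν hT u p hcl hLH hdec (hC2 ν T hν hT u p hcl hLH hdec hext))

end Summit.NavierStokesRegularity.NavierStokesRegularity.Theses.RossbyDichotomy
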